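import Literature.Computability.Complexity.GateEliminationCases5to8Split
import Literature.Computability.Complexity.GateEliminationSubstVar
import Literature.Computability.Complexity.GateEliminationAssignLin
import Literature.Computability.Complexity.GateEliminationKResynth
import Literature.Computability.Complexity.GateEliminationWires

/-!
# Gate elimination: the variable leaves of Case 6.2.2 (and Case 8.2.1) of Li–Yang's Theorem 4.1

Case 6.2.2 of §4.1 (ECCC TR21-023, p. 28–29): a protected variable `x` (a `1`-variable feeding an
⊕-type gate `P`, by Cases 1, 2) whose gate `P` reads, at its other position, a `1`-variable `u`:

* Case 6.2.2.1: "`u` is an unprotected `1`-variable. Let `y` be the couple of `x`. We substitute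
  constant value to `y` to make `x` unprotected. Then we perform affine substitution `x ← u` such
  that `P` is trivialized. These two substitutions make three variables `x`, `y` and `u`
  non-influential, resulting in `Δμ ≥ 3α_I/2 ≥ δ` per substitution."
* Case 6.2.2.2: "`u` is a protected `1`-variable, such that `x` and `u` are coupled with each
  other. We perform affine substitution `x ← u` to them, trivializing `P`. Both of `x` and `u`
  become non-influential, resulting in `Δμ ≥ 2α_I ≥ δ`." — this is also Case 8.2.1 ("`Q` is fed by
  two (protected) variables `x_j` and `x_k` which are coupled with each other … We can substitute
  `x_j ← x_k ⊕ c` to trivialize `Q` and further killing the quadratic equation").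
* Case 6.2.2.3: "`u` is a protected `1`-variable with couple `v ≠ x`. Let `y` be the couple of
  `x`. We perform constant substitution to `y` and `v` to make both `x` and `u` unprotected. Then
  we perform affine substitution `x ← u` to trivialize `P`. These three substitutions make four
  variables `x`, `y`, `u` and `v` non-influential, `Δμ ≥ 4α_I/3 ≥ δ`."

The same configuration — an ⊕-type gate fed by two `1`-variables one of which is protected — is
invoked again in Case 8.2.5.1.2 and Case 8.2.5.2.1.4 ("similar to Case 6.2.2.1 ∼ Case 6.2.2.3").
Everything here is PROVED:

* `QuadEq.linearizeCouple`, `RdqSource.assignCouple` — the source side of the affine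
  substitution `x_j := x_k ⊕ c` to a COUPLE `(x_j, x_k)` of a quadratic equation (§2.4: the
  quadratic equation becomes affine in `x_k`, `x_j` becomes linear; one quadratic equation is
  killed, the dimension drops by one), with its solution set `Sol ∩ {x_j = x_k + c}`;
* `Semicircuit.case6_2_2_sameVar` — the common tail: after `x := u ⊕ c` the gate `P` reads `u`
  twice and computes a constant; it is replaced by that constant and deleted (`ΔΦ ≤ 1`), `u`
  becoming a `0`-variable;
* `Semicircuit.case6_2_2_1`, `Semicircuit.case6_2_2_2` (= `Semicircuit.case8_2_1`),
  `Semicircuit.case6_2_2_3`, and the dispatcher over the three `Semicircuit.case6_2_2_oneVar`: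
  under the standing assumptions with no troubled gate, an ⊕-type (not ∧-type) gate reading a
  protected variable and another `1`-variable yields the one-step conclusion `StepGoal` (second
  branch, `t = 2, 1, 3` substitutions respectively).

## References

* J. Li, T. Yang, *3.1n − o(n) circuit lower bounds for explicit functions*, STOC 2022;
  ECCC TR21-023, §2.4 (affine substitution), §4.1 (Cases 6.2.2.1–6.2.2.3, 8.2.1, 8.2.5.1.2,
  8.2.5.2.1.4), Def. 3.6, Lemma 3.11.
-/

namespace Literature.Computability.Complexity

open Finset

/-! ### The affine substitution inside a couple: source side -/

namespace QuadEq

variable {n : ℕ}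

/-- **Linearization of a quadratic equation under `x_j := x_o + c`**, `x_o` the couple of `x_j`:
`((x_j + s)(x_o + s')) + c₃ = (1 + c + s + s') x_o + (c + s) s' + c₃` over `𝔽₂` (Li–Yang §2.4,
Case 8.2.1: "substitute `x_j ← x_k ⊕ c` … killing the quadratic equation containing `x_j` and
`x_k`"). [cite: LiYang2022, §2.4, §4.1 (Case 8.2.1)] -/
def linearizeCouple (e : QuadEq n) (j : Fin n) (c : ZMod 2) : LinEq n :=
  ⟨if 1 + c + e.shiftOf j + e.otherShift j = 0 then ∅ else {e.other j}, (c + e.shiftOf j) * e.otherShift j + e.c₃⟩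

/-- The support of the couple linearization is at most the couple. [folklore] -/
theorem support_linearizeCouple_subset (e : QuadEq n) (j : Fin n) (c : ZMod 2) :
    (e.linearizeCouple j c).support ⊆ {e.other j} := by
  unfold linearizeCouple
  split_ifs <;> simp

/-- **The couple linearization agrees with the quadratic expression when `x_j = x_o + c`.** [cite: LiYang2022, §2.4] -/
theorem eval_linearizeCouple (e : QuadEq n) {j : Fin n} (hr : e.Reads j) {c : ZMod 2} {v : Fin n → ZMod 2}
    (hv : v j = v (e.other j) + c) : (e.linearizeCouple j c).eval v = e.eval v := by
  have h01 : ∀ a : ZMod 2, a ≠ 0 → a = 1 := by decide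
  have hsq : ∀ a : ZMod 2, a * a = a := by decide
  unfold linearizeCouple LinEq.eval eval
  unfold other at hv
  unfold other shiftOf otherShift
  by_cases hij : e.i = j
  · subst hij
    simp only [if_true] at hv ⊢
    rw [hv]
    set t := v e.k
    by_cases h0 : 1 + c + e.c₁ + e.c₂ = 0
    · rw [if_pos h0]
      simp only [sum_empty, add_zero]
      linear_combination (-1 : ZMod 2) * hsq t - t * h0
    · rw [if_neg h0]
      have h1 := h01 _ h0
      simp only [sum_singleton]
      linear_combination (-1 : ZMod 2) * hsq t - t * h1
  · have hkj : e.k = j := hr.resolve_left hij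
    subst hkj
    simp only [hij, if_false] at hv ⊢
    rw [hv]
    set t := v e.i
    by_cases h0 : 1 + c + e.c₂ + e.c₁ = 0
    · rw [if_pos h0]
      simp only [sum_empty, add_zero]
      linear_combination (-1 : ZMod 2) * hsq t - t * h0
    · rw [if_neg h0]
      have h1 := h01 _ h0
      simp only [sum_singleton]
      linear_combination (-1 : ZMod 2) * hsq t - t * h1

end QuadEq

namespace RdqSource

variable {n : ℕ} {R : RdqSource n}

/-- The intermediate source: the quadratic equation `e` of `x_l` linearized along `x_j := x_o + c`. [folklore] -/
abbrev linearizeCoupleAt {l : Fin n} {e : QuadEq n} (he : R.quad l = some e) (j : Fin n) (c : ZMod 2) :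
    RdqSource n :=
  R.setLin l (e.linearizeCouple j c) (by rw [he]; rfl) fun i hi => by
    have := e.support_linearizeCouple_subset j c hi
    rw [mem_singleton] at this
    rw [this]
    exact free_other he j

/-- After linearizing its quadratic equation, `x_j` is free. [folklore] -/
theorem free_linearizeCoupleAt {l : Fin n} {e : QuadEq n} (he : R.quad l = some e) {j : Fin n}
    (hr : e.Reads j) (c : ZMod 2) : (linearizeCoupleAt he j c).Free j :=
  (free_setLin_iff _ _ j).mpr (free_of_reads he hr)

/-- After linearizing its quadratic equation, `x_j` is unprotected (read-once). [folklore] -/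
theorem not_protected_linearizeCoupleAt {l : Fin n} {e : QuadEq n} (he : R.quad l = some e) {j : Fin n}
    (hr : e.Reads j) (c : ZMod 2) : ¬ (linearizeCoupleAt he j c).Protected j :=
  not_protected_setLin_of_reads _ _ he hr

/-- The affine right-hand side `x_o + c` is admissible after the linearization. [folklore] -/
theorem couple_support_ok {l : Fin n} {e : QuadEq n} (he : R.quad l = some e) {j : Fin n}
    (hr : e.Reads j) (c : ZMod 2) :
    ∀ i ∈ (⟨{e.other j}, c⟩ : LinEq n).support, (linearizeCoupleAt he j c).lin i = none ∧ i ≠ j := by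
  intro i hi
  have hi' : i = e.other j := by simpa using hi
  subst hi'
  have hfo : R.Free (e.other j) := free_other he j
  have hol : e.other j ≠ l := fun h => not_free_of_quad he (h ▸ hfo)
  refine ⟨?_, e.other_ne hr (R.quad_wf l e he).2.2⟩
  rw [setLin_lin, if_neg hol, hfo.1]
  rfl

/-- The rdq-source after the **affine substitution `x_j := x_o ⊕ c` to a protected variable
`x_j` with couple `x_o`** (read together by the quadratic equation `e` of `x_l`): that equation
becomes affine in `x_o` (so `x_l` becomes linear and `x_o` unprotected), and `x_j` becomes linear
with `x_j = x_o + c` (Li–Yang §2.4; Case 8.2.1: "substitute `x_j ← x_k ⊕ c` … killing the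
quadratic equation containing `x_j` and `x_k`"; Case 6.2.2.2: "affine substitution `x ← u` to
them"). [cite: LiYang2022, §2.4, §4.1 (Cases 6.2.2.2, 8.2.1)] -/
def assignCouple {l : Fin n} {e : QuadEq n} (he : R.quad l = some e) {j : Fin n} (hr : e.Reads j)
    (c : ZMod 2) : RdqSource n :=
  (linearizeCoupleAt he j c).assignLin j ⟨{e.other j}, c⟩ (free_linearizeCoupleAt he hr c)
    (not_protected_linearizeCoupleAt he hr c) (couple_support_ok he hr c)

section AssignCouple

variable {j l : Fin n} {e : QuadEq n} (he : R.quad l = some e) (hr : e.Reads j) (c : ZMod 2)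

/-- Free variables after `assignCouple`: all but `x_j`. [cite: LiYang2022, §2.4] -/
theorem free_assignCouple_iff (i : Fin n) : (assignCouple he hr c).Free i ↔ R.Free i ∧ i ≠ j := by
  unfold assignCouple
  rw [free_assignLin_iff, free_setLin_iff]

/-- **`assignCouple` lowers the dimension by one.** [cite: LiYang2022, §2.4] -/
theorem dim_assignCouple : (assignCouple he hr c).dim + 1 = R.dim := by
  unfold assignCouple
  rw [dim_assignLin, dim_setLin]

/-- **`assignCouple` kills one quadratic equation.** [cite: LiYang2022, §2.4] -/
theorem quadCount_assignCouple : (assignCouple he hr c).quadCount + 1 = R.quadCount := by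
  unfold assignCouple
  rw [quadCount_assignLin, quadCount_setLin]

/-- Protected variables after `assignCouple`: those of the other quadratic equations. [folklore] -/
theorem protected_assignCouple_iff (i : Fin n) :
    (assignCouple he hr c).Protected i ↔
      R.Free i ∧ i ≠ j ∧ ∃ (l' : Fin n) (e' : QuadEq n), l' ≠ l ∧ R.quad l' = some e' ∧ e'.Reads i := by
  unfold assignCouple
  rw [protected_assignLin_iff, protected_setLin_iff]
  constructor
  · rintro ⟨hf, l', e', hl', h', hr'⟩
    refine ⟨hf, ?_, l', e', hl', h', hr'⟩
    rintro rfl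
    exact hl' (quad_unique_of_reads h' he hr' hr).1
  · rintro ⟨hf, -, l', e', hl', h', hr'⟩
    exact ⟨hf, l', e', hl', h', hr'⟩

/-- A variable protected after `assignCouple` was protected before. [folklore] -/
theorem protected_of_protected_assignCouple {i : Fin n} (h : (assignCouple he hr c).Protected i) :
    R.Protected i := by
  obtain ⟨hf, -, l', e', -, h', hr'⟩ := (protected_assignCouple_iff he hr c i).mp h
  exact ⟨hf, l', e', h', hr'⟩

/-- The variables of the killed quadratic equation (`x_j` and its couple) are no longer
protected. [folklore] -/
theorem not_protected_assignCouple_of_reads {i : Fin n} (hi : e.Reads i) :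
    ¬ (assignCouple he hr c).Protected i := by
  intro h
  obtain ⟨-, -, l', e', hl', h', hr'⟩ := (protected_assignCouple_iff he hr c i).mp h
  exact hl' (quad_unique_of_reads h' he hr' hi).1

/-- **Solutions after `assignCouple`**: the old solutions with `x_j = x_o + c`. [cite: LiYang2022, Prop. 2.6] -/
theorem mem_sol_assignCouple_iff (v : Fin n → ZMod 2) :
    v ∈ (assignCouple he hr c).Sol ↔ v ∈ R.Sol ∧ v j = v (e.other j) + c := by
  unfold assignCouple
  rw [mem_sol_assignLin_iff, mem_sol_setLin_iff, mem_sol_iff]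
  have hev : (⟨{e.other j}, c⟩ : LinEq n).eval v = v (e.other j) + c := by
    show c + ∑ i ∈ ({e.other j} : Finset (Fin n)), v i = _
    rw [sum_singleton, add_comm]
  rw [hev]
  constructor
  · rintro ⟨⟨hvl, hlin, hquad⟩, hvj⟩
    refine ⟨⟨hlin, fun i e' hi => ?_⟩, hvj⟩
    by_cases hil : i = l
    · subst hil
      rw [he] at hi
      obtain rfl := Option.some.inj hi
      rw [hvl, QuadEq.eval_linearizeCouple _ hr hvj]
    · exact hquad i e' hil hi
  · rintro ⟨⟨hlin, hquad⟩, hvj⟩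
    refine ⟨⟨?_, hlin, fun i e' _ hi => hquad i e' hi⟩, hvj⟩
    rw [QuadEq.eval_linearizeCouple _ hr hvj]
    exact hquad l e he

/-- Solutions after `assignCouple`, as a set. [cite: LiYang2022, Prop. 2.6] -/
theorem sol_assignCouple : (assignCouple he hr c).Sol = R.Sol ∩ {v | v j = v (e.other j) + c} :=
  Set.ext fun v => mem_sol_assignCouple_iff he hr c v

end AssignCouple

end RdqSource

/-! ### The circuit side -/

namespace Semicircuit

variable {n : ℕ} {C : Semicircuit n} {f : (Fin n → ZMod 2) → Bool} {R : RdqSource n} {d : ℕ} {αφ αI αQ : ℝ}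

/-- **The common tail of Cases 6.2.2.1–6.2.2.3**: a gate `k₀` whose two wires go to the same
variable `u` and whose function is constant on the diagonal ("`P` is trivialized" after
`x ← u ⊕ c`) is replaced by that constant and deleted (`ΔΦ ≤ 1`); if these were the only wires of
`u` and `u` is unprotected, `u` becomes non-influential: `μ' ≤ μ - (1 - α_φ) - α_I`.
[cite: LiYang2022, §4.1 (Case 6.2.2), Lemma 3.11 (Rule 5)] -/
theorem case6_2_2_sameVar {D : Semicircuit n} {R' : RdqSource n} (hf : IsAffineDisperser f d) (hd : 2 * d ≤ R'.dim)
    (hF : D.Fair) (hC : D.ComputesRestr f R') {P : Finset (Fin D.m × Fin D.m)} (hP : D.IsPacking P)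
    {k₀ : Fin D.m} {u : Fin n} (h0 : D.arg k₀ 0 = .var u) (h1 : D.arg k₀ 1 = .var u)
    {c : Bool} (hconst : ∀ t, D.op k₀ t t = c) (hu2 : D.fanout (.var u) = 2) (hup : ¬ R'.Protected u)
    (hφ : 0 ≤ αφ) (hI : 0 ≤ αI) (αQ : ℝ) :
    ∃ (D' : Semicircuit n) (P' : Finset (Fin D'.m × Fin D'.m)), D'.Fair ∧ D'.ComputesRestr f R' ∧
      D'.IsPacking P' ∧ D'.m + 1 = D.m ∧
      D'.measure αφ αI αQ P' R' ≤ D.measure αφ αI αQ P R' - (1 - αφ) - αI := by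
  classical
  have hid : ∀ (x : Fin n → Bool) (w : Fin D.m → Bool),
      D.op k₀ (D.nodeVal x w (D.arg k₀ 0)) (D.nodeVal x w (D.arg k₀ 1)) = c := by
    intro x w; rw [h0, h1]; exact hconst _
  have hself : ∀ a, D.arg k₀ a ≠ .gate k₀ := by
    intro a ha
    rcases fin2_eq_or_eq_rev 0 a with rfl | rfl
    · rw [h0] at ha; cases ha
    · rw [show (0 : Fin 2).rev = 1 from rfl, h1] at ha; cases ha
  have hout : D.out ≠ .gate k₀ :=
    out_ne_of_semConst hf hd hF hC (fun x w hw => by rw [hw k₀]; exact hid x w)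
  let E := elimDataWRedirectConst hF hC hP c hid (Or.inl (h0.trans h1.symm)) hself hout hφ hI αQ
  have hrepl : E.repl = .const c := rfl
  -- `u` is a `0`-variable afterwards, hence not influential
  have hu0 : E.C'.fanout (.var u) = 0 := by
    have h := E.fanout_var_add (i := u) (by rw [hrepl]; exact fun h => by cases h)
    have hc2 : (univ.filter fun a : Fin 2 => D.arg k₀ a = .var u).card = 2 := by
      have : (univ.filter fun a : Fin 2 => D.arg k₀ a = .var u) = univ := by
        apply filter_true_of_mem
        intro a _
        rcases fin2_eq_or_eq_rev 0 a with rfl | rfl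
        · exact h0
        · exact h1
      rw [this, card_univ, Fintype.card_fin]
    rw [hc2, hu2] at h
    omega
  have huinf : u ∈ D.influential R' := by
    unfold influential; rw [mem_filter]; exact ⟨mem_univ _, Or.inl (by rw [hu2]; norm_num)⟩
  have huinf' : u ∉ E.C'.influential R' := by
    unfold influential; rw [mem_filter, hu0]; push Not
    exact fun _ => ⟨by norm_num, hup⟩
  have hinf : ((E.C'.influential R').card : ℝ) + 1 ≤ (D.influential R').card := by
    have hsub : E.C'.influential R' ⊆ (D.influential R').erase u := fun i hi =>
      mem_erase.mpr ⟨fun h => huinf' (h ▸ hi), E.influential_subset R' hi⟩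
    have h₁ := card_le_card hsub
    have h₂ := card_erase_add_one huinf
    have : (E.C'.influential R').card + 1 ≤ (D.influential R').card := by omega
    exact_mod_cast this
  refine ⟨E.C', E.P', E.fair, E.computes, E.packing, E.m_add_one, ?_⟩
  have hpot := E.potential_le
  have hm : ((E.C'.m : ℕ) : ℝ) + 1 = D.m := by exact_mod_cast E.m_add_one
  unfold measure
  nlinarith [mul_le_mul_of_nonneg_left hinf hI, mul_le_mul_of_nonneg_left hpot hφ]

/-- **The affine substitution `x ← u ⊕ c` of Case 6.2.2** (core step, source abstract): `P`
is ⊕-type and reads the `1`-variables `x` (at `a`) and `u` (at `a.rev`); `R₁` is the source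
after `x := u + c` (solutions `Sol R₀ ∩ {x = u + c}`, free variables those of `R₀` but `x`, no
new protected variable, `u` unprotected). Then `C[x := u ⊕ c]` computes `f|_{R₁}`, `P` reads `u`
twice and is constant ("`P` is trivialized"), and after its deletion both `x` and `u` are
non-influential: `μ' ≤ μ - (1 - 2α_φ) - 2α_I - α_Q (q₀ - q₁)`, one gate fewer.
[cite: LiYang2022, §2.4, §4.1 (Case 6.2.2)] -/
theorem case6_2_2_core {R₀ R₁ : RdqSource n} (hf : IsAffineDisperser f d) (hd : 2 * d ≤ R₁.dim)
    (hF : C.Fair) (hC : C.ComputesRestr f R₀) {P₀ : Finset (Fin C.m × Fin C.m)} (hP₀ : C.IsPacking P₀)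
    {P : Fin C.m} {a : Fin 2} {x u : Fin n} (hPx : C.arg P a = .var x) (hPu : C.arg P a.rev = .var u)
    (hxu : x ≠ u) (hxor : IsXorOp (C.op P)) (hx1 : C.fanout (.var x) = 1) (hu1 : C.fanout (.var u) = 1)
    {c : ZMod 2} (hsol : ∀ v, v ∈ R₁.Sol ↔ v ∈ R₀.Sol ∧ v x = v u + c) (hfree : ∀ i, R₁.Free i ↔ R₀.Free i ∧ i ≠ x)
    (hufree : R₀.Free u) (hprot : ∀ i, R₁.Protected i → R₀.Protected i) (hup : ¬ R₁.Protected u)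
    (hdim : R₁.dim + 1 = R₀.dim) (hφ : 0 ≤ αφ) (hI : 0 ≤ αI) (hq : R₁.quadCount ≤ R₀.quadCount) :
    ∃ (D' : Semicircuit n) (P' : Finset (Fin D'.m × Fin D'.m)), D'.Fair ∧ D'.ComputesRestr f R₁ ∧
      D'.IsPacking P' ∧ D'.m + 1 = C.m ∧
      D'.measure αφ αI αQ P' R₁ ≤ C.measure αφ αI αQ P₀ R₀ - (1 - 2 * αφ) - 2 * αI
        - αQ * ((R₀.quadCount : ℝ) - R₁.quadCount) := by
  classical
  obtain ⟨ko, hko⟩ := exists_out_eq_gate' hf hF hC (by omega)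
  have hout : C.out ≠ .var x := by rw [hko]; exact fun h => by cases h
  -- the circuit after `x := u ⊕ c`
  let b : Bool := finTwoEquiv c
  let D := C.substVar x u b
  have hF₁ : D.Fair := hF.substVar x u b
  have hC₁ : D.ComputesRestr f R₁ := hC.substVar hxu.symm hsol hfree hufree hout
  obtain ⟨P₁, hP₁, hpot₁⟩ := C.exists_packing_substVar x u b hxu.symm hP₀
  -- the wires of `P` coincide at `u`
  have hwa : D.arg P a = .var u := by
    show (C.arg P a).substVar x u = .var u; rw [hPx, Node.substVar_var_self]
  have hwr : D.arg P a.rev = .var u := by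
    show (C.arg P a.rev).substVar x u = .var u; rw [hPu, Node.substVar_var_of_ne hxu.symm]
  have hw : ∀ a', D.arg P a' = .var u := by
    intro a'
    rcases fin2_eq_or_eq_rev a a' with rfl | rfl
    · exact hwa
    · exact hwr
  obtain ⟨c₀, hc₀⟩ := hxor
  have hconst : ∀ t, D.op P t t = (b ^^ c₀) := by
    intro t
    show (C.substVar x u b).op P t t = _
    rw [C.substVar_op_self hxu.symm hPx hPu b t]
    split_ifs <;> rw [hc₀] <;> cases t <;> cases b <;> cases c₀ <;> rfl
  have hu2 : D.fanout (.var u) = 2 := by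
    show (C.substVar x u b).fanout (.var u) = 2
    rw [C.fanout_substVar_var_target x u b hxu.symm, hu1, hx1]
  obtain ⟨D', P', hF', hC', hP', hm', hμ'⟩ :=
    case6_2_2_sameVar (D := D) hf hd hF₁ hC₁ hP₁ (hw 0) (hw 1) hconst hu2 hup hφ hI αQ
  refine ⟨D', P', hF', hC', hP', hm', ?_⟩
  -- accounting for the substitution: `x` is no longer influential, `Φ` grows by at most one
  have hxinf : x ∈ C.influential R₀ := C.mem_influential_of_reads R₀ hPx
  have huinf : u ∈ C.influential R₀ := C.mem_influential_of_reads R₀ hPu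
  have hinf₁ : ((D.influential R₁).card : ℝ) + 1 ≤ (C.influential R₀).card := by
    have hfreej : ¬ R₁.Free x := fun h => ((hfree x).mp h).2 rfl
    have h1 := C.influential_substVar_subset x u b hxu.symm hfreej hprot
    have h2 : insert u ((C.influential R₀).erase x) = (C.influential R₀).erase x :=
      insert_eq_of_mem (mem_erase.mpr ⟨hxu.symm, huinf⟩)
    rw [h2] at h1
    have h3 := card_le_card h1
    change (D.influential R₁).card ≤ _ at h3
    have h4 := card_erase_add_one hxinf
    have : (D.influential R₁).card + 1 ≤ (C.influential R₀).card := by omega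
    exact_mod_cast this
  have hq' : ((R₁.quadCount : ℕ) : ℝ) ≤ R₀.quadCount := by exact_mod_cast hq
  have hμ₁ : D.measure αφ αI αQ P₁ R₁ ≤ C.measure αφ αI αQ P₀ R₀ - αI - αQ * ((R₀.quadCount : ℝ) - R₁.quadCount) + αφ := by
    unfold measure
    show ((C.m : ℕ) : ℝ) + _ + _ + _ ≤ _
    nlinarith [mul_le_mul_of_nonneg_left hinf₁ hI, mul_le_mul_of_nonneg_left hpot₁ hφ]
  linarith

/-! ### Cases 6.2.2.1–6.2.2.3 under the standing assumptions -/

section Standing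

/-- Under the standing assumptions a protected variable is a `1`-variable (Cases 1, 2 and no
coinciding wires). [cite: LiYang2022, §4.1 (Cases 1, 2)] -/
theorem Standing.fanout_eq_one_of_protected (hS : C.Standing R) {x : Fin n} (hxp : R.Protected x) {P : Fin C.m} {a : Fin 2}
    (hPx : C.arg P a = .var x) : C.fanout (.var x) = 1 := by
  classical
  rw [C.fanout_eq_card_readers hS.normalized.1.arg_zero_ne_arg_one, card_eq_one]
  refine ⟨P, eq_singleton_iff_unique_mem.mpr ⟨mem_filter.mpr ⟨mem_univ _, a, hPx⟩, fun k hk => ?_⟩⟩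
  obtain ⟨-, a', ha'⟩ := mem_filter.mp hk
  exact hS.protected_one_reader x hxp k P a' a ha' hPx

/-- Under the standing assumptions a gate reading a protected variable is ⊕-type (not ∧-type by
Case 1, hence affine, hence ⊕-type by non-degeneracy). [cite: LiYang2022, §4.1 (Cases 0.3, 1)] -/
theorem Standing.isXorOp_of_protected (hS : C.Standing R) {x : Fin n} (hxp : R.Protected x) {P : Fin C.m} {a : Fin 2}
    (hPx : C.arg P a = .var x) : IsXorOp (C.op P) :=
  C.isXorOp_of_isAffineOp hS.nonDegenerate
    ((isAndOp_or_isAffineOp _).resolve_left (hS.protected_not_and x hxp P a hPx))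

/-- Two wires of one gate to variables go to distinct variables (no coinciding wires). [folklore] -/
theorem ne_of_arg_var (hN : C.PreNormalized) {P : Fin C.m} {a : Fin 2} {x u : Fin n}
    (hPx : C.arg P a = .var x) (hPu : C.arg P a.rev = .var u) : x ≠ u := by
  rintro rfl
  apply hN.arg_zero_ne_arg_one P
  rcases fin2_eq_or_eq_rev 0 a with rfl | h
  · have h1 : C.arg P 1 = .var x := hPu
    rw [hPx, h1]
  · have ha : a = 1 := h
    subst ha
    have h0 : C.arg P 0 = .var x := hPu
    rw [h0, hPx]

/-- A quadratic equation reads the couple. [folklore] -/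
theorem _root_.Literature.Computability.Complexity.QuadEq.reads_other (e : QuadEq n) (j : Fin n) : e.Reads (e.other j) := by
  rcases e.other_mem j with h | h
  · exact Or.inl h.symm
  · exact Or.inr h.symm

/-- If a quadratic equation reads two distinct variables, each is the couple of the other. [folklore] -/
theorem _root_.Literature.Computability.Complexity.QuadEq.other_eq_of_reads (e : QuadEq n) {j k : Fin n}
    (hj : e.Reads j) (hk : e.Reads k) (hjk : j ≠ k) : e.other j = k := by
  unfold QuadEq.other
  split_ifs with h
  · rcases hk with hk | hk
    · exact absurd (h.symm.trans hk) hjk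
    · exact hk
  · rcases hj with hj | hj
    · exact absurd hj h
    · rcases hk with hk | hk
      · exact hk
      · exact absurd (hj.symm.trans hk) hjk

/-- The quadratic equations other than the killed one survive `assignProtected`. [folklore] -/
theorem _root_.Literature.Computability.Complexity.RdqSource.assignProtected_quad_of_ne {R : RdqSource n}
    {l l' j : Fin n} {e : QuadEq n} (he : R.quad l = some e) (hr : e.Reads j) (b : ZMod 2) (h : l' ≠ l) :
    (RdqSource.assignProtected he hr b).quad l' = R.quad l' := by
  unfold RdqSource.assignProtected
  rw [RdqSource.assignFree_quad]
  dsimp only [RdqSource.linearizeAt]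
  rw [RdqSource.setLin_quad, if_neg h]

/-- **Case 6.2.2.2 of the proof of Thm. 4.1** (= Case 8.2.1): a gate `P` reads the protected
variable `x` and its couple `u` ("`u` is a protected `1`-variable, such that `x` and `u` are
coupled with each other. We perform affine substitution `x ← u` to them, trivializing `P`. Both
of `x` and `u` become non-influential, resulting in `Δμ ≥ 2α_I ≥ δ`"): one substitution
`x := u` inside the couple (the quadratic equation is killed), `P` becomes constant and is
deleted. [cite: LiYang2022, §4.1 (Cases 6.2.2.2, 8.2.1)] -/
theorem case6_2_2_2 (hf : IsAffineDisperser f d) (hd : 2 * d + 2 < R.dim) (hF : C.Fair)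
    (hC : C.ComputesRestr f R) (hS : C.Standing R) (hφ : 0 ≤ αφ) (hφ2 : αφ ≤ 1 / 2) (hI : 0 ≤ αI) (hQ : 0 ≤ αQ)
    {P : Fin C.m} {a : Fin 2} {x u l : Fin n} {e : QuadEq n}
    (hPx : C.arg P a = .var x) (hPu : C.arg P a.rev = .var u)
    (he : R.quad l = some e) (hex : e.Reads x) (heu : e.other x = u) : C.StepGoal f R αφ αI αQ := by
  classical
  have hN := hS.normalized.1
  have hxp : R.Protected x := RdqSource.protected_of_reads he hex
  have hur : e.Reads u := heu ▸ e.reads_other x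
  have hup : R.Protected u := RdqSource.protected_of_reads he hur
  have hxu : x ≠ u := ne_of_arg_var hN hPx hPu
  have hx1 := hS.fanout_eq_one_of_protected hxp hPx
  have hu1 := hS.fanout_eq_one_of_protected hup hPu
  have hxor := hS.isXorOp_of_protected hxp hPx
  -- the source after `x := u + 0`
  let R₁ := RdqSource.assignCouple he hex 0
  have hsol : ∀ v, v ∈ R₁.Sol ↔ v ∈ R.Sol ∧ v x = v u + 0 := fun v => by
    rw [RdqSource.mem_sol_assignCouple_iff, heu]
  have hfree : ∀ i, R₁.Free i ↔ R.Free i ∧ i ≠ x := RdqSource.free_assignCouple_iff he hex 0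
  have hprot : ∀ i, R₁.Protected i → R.Protected i := fun i h =>
    RdqSource.protected_of_protected_assignCouple he hex 0 h
  have hup₁ : ¬ R₁.Protected u := RdqSource.not_protected_assignCouple_of_reads he hex 0 hur
  have hdim : R₁.dim + 1 = R.dim := RdqSource.dim_assignCouple he hex 0
  have hq : R₁.quadCount + 1 = R.quadCount := RdqSource.quadCount_assignCouple he hex 0
  obtain ⟨D', P', hF', hC', hP', -, hμ'⟩ := case6_2_2_core (αQ := αQ) hf (by omega) hF hC C.isPacking_empty hPx hPu hxu hxor
    hx1 hu1 hsol hfree hup.1 hprot hup₁ hdim hφ hI (by omega)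
  refine Or.inr ⟨1, le_rfl, by norm_num, D', R₁, P', hF', hC', hP', hdim, ?_⟩
  have hδ := liYangDelta_le_four_thirds αφ αI αQ
  have hq' : ((R.quadCount : ℕ) : ℝ) = R₁.quadCount + 1 := by exact_mod_cast hq.symm
  simp only [Nat.cast_one, mul_one]
  rw [hq'] at hμ'
  nlinarith

/-- **Case 8.2.1 of the proof of Thm. 4.1**: "Assume that one of `P` and `Q`, say `Q`, is fed
by two (protected) variables `x_j` and `x_k` which are coupled with each other. By Case 1 and
Case 2, both of them are `1`-variables. We can substitute `x_j ← x_k ⊕ c` to trivialize `Q` and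
further killing the quadratic equation containing `x_j` and `x_k`. This will make both of the two
variables non-influential, giving `Δμ ≥ 2α_I ≥ δ`." (The same move as Case 6.2.2.2.)
[cite: LiYang2022, §4.1 (Case 8.2.1)] -/
theorem case8_2_1 (hf : IsAffineDisperser f d) (hd : 2 * d + 2 < R.dim) (hF : C.Fair)
    (hC : C.ComputesRestr f R) (hS : C.Standing R) (hφ : 0 ≤ αφ) (hφ2 : αφ ≤ 1 / 2) (hI : 0 ≤ αI) (hQ : 0 ≤ αQ)
    {Q : Fin C.m} {a : Fin 2} {j k l : Fin n} {e : QuadEq n}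
    (hQj : C.arg Q a = .var j) (hQk : C.arg Q a.rev = .var k)
    (he : R.quad l = some e) (hej : e.Reads j) (hek : e.other j = k) : C.StepGoal f R αφ αI αQ :=
  case6_2_2_2 hf hd hF hC hS hφ hφ2 hI hQ hQj hQk he hej hek

/-- **Case 6.2.2.1 of the proof of Thm. 4.1**: a gate `P` reads the protected variable `x` and
an unprotected `1`-variable `u` ("Let `y` be the couple of `x`. We substitute constant value to
`y` to make `x` unprotected. Then we perform affine substitution `x ← u` such that `P` is
trivialized. These two substitutions make three variables `x`, `y` and `u` non-influential,
resulting in `Δμ ≥ 3α_I/2 ≥ δ` per substitution"). [cite: LiYang2022, §4.1 (Case 6.2.2.1)] -/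
theorem case6_2_2_1 (hf : IsAffineDisperser f d) (hd : 2 * d + 2 < R.dim) (hF : C.Fair)
    (hC : C.ComputesRestr f R) (hS : C.Standing R) (hφ : 0 ≤ αφ) (hφ2 : αφ ≤ 1 / 2) (hI : 0 ≤ αI) (hQ : 0 ≤ αQ)
    {P : Fin C.m} {a : Fin 2} {x u : Fin n}
    (hPx : C.arg P a = .var x) (hPu : C.arg P a.rev = .var u) (hxp : R.Protected x) (hup : ¬ R.Protected u)
    (hu1 : C.fanout (.var u) = 1) : C.StepGoal f R αφ αI αQ := by
  classical
  have hN := hS.normalized.1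
  have hx1 := hS.fanout_eq_one_of_protected hxp hPx
  have hxor := hS.isXorOp_of_protected hxp hPx
  obtain ⟨hxfree, l, e, he, hex⟩ := hxp
  have hex : e.Reads x := hex
  have hxu : x ≠ u := ne_of_arg_var hN hPx hPu
  -- the couple `y` of `x`
  set y := e.other x with hy
  have hyr : e.Reads y := e.reads_other x
  have hyp : R.Protected y := RdqSource.protected_of_reads he hyr
  have hyx : y ≠ x := e.other_ne hex (R.quad_wf l e he).2.2
  have hyu : y ≠ u := fun h => hup (h ▸ hyp)
  have hufree : R.Free u := free_of_reads hC hPu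
  -- step 1: `y := 0`
  let C₁ := C.substConst y (finTwoEquiv 0)
  let R₁ := RdqSource.assignProtected he hyr 0
  have hF₁ : C₁.Fair := hF.substConst y _
  have hC₁ : C₁.ComputesRestr f R₁ := hC.substConst_assignProtected he hyr 0
  have hP₁ : C₁.IsPacking (C.substConstPacking y (finTwoEquiv 0) ∅) := C.isPacking_empty.substConst
  have hyinf : y ∈ C.influential R := mem_filter.mpr ⟨mem_univ _, Or.inr hyp⟩
  have hinf₁ : ((C₁.influential R₁).card : ℝ) + 1 ≤ (C.influential R).card := by
    have h1 := C.influential_substConst_assignProtected_subset he hyr 0 (finTwoEquiv 0)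
    have h2 : C₁.influential R₁ ⊆ (C.influential R).erase y := fun i hi => (mem_filter.mp (h1 hi)).1
    have h3 := card_le_card h2
    have h4 := card_erase_add_one hyinf
    have : (C₁.influential R₁).card + 1 ≤ (C.influential R).card := by omega
    exact_mod_cast this
  have hq₁ : R₁.quadCount + 1 = R.quadCount := RdqSource.quadCount_assignProtected he hyr 0
  have hdim₁ : R₁.dim + 1 = R.dim := RdqSource.dim_assignProtected he hyr 0
  have hμ₁ : C₁.measure αφ αI αQ (C.substConstPacking y (finTwoEquiv 0) ∅) R₁ ≤ C.measure αφ αI αQ ∅ R - αI - αQ := by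
    have h := C.measure_substConst_le hφ αI αQ C.isPacking_empty R R₁ y (finTwoEquiv 0)
    have hq' : ((R.quadCount : ℕ) : ℝ) = R₁.quadCount + 1 := by exact_mod_cast hq₁.symm
    rw [hq'] at h
    nlinarith
  -- wires and out-degrees at `P` are unchanged
  have hPx₁ : C₁.arg P a = .var x := by
    show (C.arg P a).substConst y _ = _; rw [hPx, Node.substConst_var_of_ne hyx.symm]
  have hPu₁ : C₁.arg P a.rev = .var u := by
    show (C.arg P a.rev).substConst y _ = _; rw [hPu, Node.substConst_var_of_ne hyu.symm]
  have hx1₁ : C₁.fanout (.var x) = 1 := by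
    show (C.substConst y (finTwoEquiv 0)).fanout (.var x) = 1
    rw [C.fanout_substConst_var_of_ne _ _ hyx.symm]; exact hx1
  have hu1₁ : C₁.fanout (.var u) = 1 := by
    show (C.substConst y (finTwoEquiv 0)).fanout (.var u) = 1
    rw [C.fanout_substConst_var_of_ne _ _ hyu.symm]; exact hu1
  have hxor₁ : IsXorOp (C₁.op P) := hxor
  -- step 2: the source after `x := u + 0`
  have hxfree₁ : R₁.Free x := (RdqSource.free_assignProtected_iff he hyr 0 x).mpr ⟨hxfree, hyx.symm⟩
  have hxp₁ : ¬ R₁.Protected x := RdqSource.not_protected_assignProtected_of_reads he hyr 0 hex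
  have hufree₁ : R₁.Free u := (RdqSource.free_assignProtected_iff he hyr 0 u).mpr ⟨hufree, hyu.symm⟩
  let Eq : LinEq n := ⟨{u}, 0⟩
  have hEq : ∀ i ∈ Eq.support, R₁.lin i = none ∧ i ≠ x := by
    intro i hi
    have : i = u := by simpa [Eq] using hi
    subst this
    exact ⟨hufree₁.1, hxu.symm⟩
  let R₂ := R₁.assignLin x Eq hxfree₁ hxp₁ hEq
  have hsol : ∀ v, v ∈ R₂.Sol ↔ v ∈ R₁.Sol ∧ v x = v u + 0 := by
    intro v
    rw [RdqSource.mem_sol_assignLin_iff]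
    have : Eq.eval v = v u + 0 := by
      show (0 : ZMod 2) + ∑ i ∈ ({u} : Finset (Fin n)), v i = _
      rw [sum_singleton, add_comm]
    rw [this]
  have hfree : ∀ i, R₂.Free i ↔ R₁.Free i ∧ i ≠ x := RdqSource.free_assignLin_iff hxfree₁ hxp₁ hEq
  have hprot : ∀ i, R₂.Protected i → R₁.Protected i := fun i h =>
    (RdqSource.protected_assignLin_iff hxfree₁ hxp₁ hEq i).mp h
  have hup₁ : ¬ R₁.Protected u := fun h => hup (RdqSource.protected_of_protected_assignProtected he hyr 0 h)
  have hup₂ : ¬ R₂.Protected u := fun h => hup₁ (hprot u h)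
  have hdim₂ : R₂.dim + 1 = R₁.dim := RdqSource.dim_assignLin hxfree₁ hxp₁ hEq
  have hq₂ : R₂.quadCount = R₁.quadCount := RdqSource.quadCount_assignLin hxfree₁ hxp₁ hEq
  obtain ⟨D', P', hF', hC', hP', -, hμ'⟩ := case6_2_2_core (C := C₁) (αQ := αQ) hf (by omega) hF₁ hC₁ hP₁ hPx₁ hPu₁ hxu hxor₁
    hx1₁ hu1₁ hsol hfree hufree₁ hprot hup₂ hdim₂ hφ hI hq₂.le
  refine Or.inr ⟨2, by norm_num, by norm_num, D', R₂, P', hF', hC', hP', by omega, ?_⟩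
  have hδ := liYangDelta_le_four_thirds αφ αI αQ
  have hq' : ((R₁.quadCount : ℕ) : ℝ) - R₂.quadCount = 0 := by rw [hq₂]; ring
  rw [hq', mul_zero, sub_zero] at hμ'
  push_cast
  nlinarith

/-- **Case 6.2.2.3 of the proof of Thm. 4.1**: a gate `P` reads the protected variable `x` and a
protected variable `u` of ANOTHER couple ("`u` is a protected `1`-variable with couple `v ≠ x`.
Let `y` be the couple of `x`. We perform constant substitution to `y` and `v` to make both `x`
and `u` unprotected. Then we perform affine substitution `x ← u` to trivialize `P`. These three
substitutions make four variables `x`, `y`, `u` and `v` non-influential, `Δμ ≥ 4α_I/3 ≥ δ`").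
[cite: LiYang2022, §4.1 (Case 6.2.2.3)] -/
theorem case6_2_2_3 (hf : IsAffineDisperser f d) (hd : 2 * d + 2 < R.dim) (hF : C.Fair)
    (hC : C.ComputesRestr f R) (hS : C.Standing R) (hφ : 0 ≤ αφ) (hφ2 : αφ ≤ 1 / 2) (hI : 0 ≤ αI) (hQ : 0 ≤ αQ)
    {P : Fin C.m} {a : Fin 2} {x u l l' : Fin n} {e e' : QuadEq n}
    (hPx : C.arg P a = .var x) (hPu : C.arg P a.rev = .var u)
    (he : R.quad l = some e) (hex : e.Reads x) (he' : R.quad l' = some e') (heu : e'.Reads u) (hll : l ≠ l') :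
    C.StepGoal f R αφ αI αQ := by
  classical
  have hN := hS.normalized.1
  have hxp : R.Protected x := RdqSource.protected_of_reads he hex
  have hup : R.Protected u := RdqSource.protected_of_reads he' heu
  have hx1 := hS.fanout_eq_one_of_protected hxp hPx
  have hu1 := hS.fanout_eq_one_of_protected hup hPu
  have hxor := hS.isXorOp_of_protected hxp hPx
  have hxu : x ≠ u := ne_of_arg_var hN hPx hPu
  -- the couples `y` of `x` and `v` of `u`; all four are distinct
  set y := e.other x with hy
  set v := e'.other u with hv
  have hyr : e.Reads y := e.reads_other x
  have hvr : e'.Reads v := e'.reads_other u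
  have hyp : R.Protected y := RdqSource.protected_of_reads he hyr
  have hyx : y ≠ x := e.other_ne hex (R.quad_wf l e he).2.2
  have hvu : v ≠ u := e'.other_ne heu (R.quad_wf l' e' he').2.2
  have cross : ∀ {i}, e.Reads i → e'.Reads i → False := fun hi hi' =>
    hll (RdqSource.quad_unique_of_reads he he' hi hi').1
  have hyu : y ≠ u := fun h => cross hyr (h ▸ heu)
  have hyv : y ≠ v := fun h => cross hyr (h ▸ hvr)
  have hxv : x ≠ v := fun h => cross hex (h ▸ hvr)
  -- step 1: `y := 0`
  let C₁ := C.substConst y (finTwoEquiv 0)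
  let R₁ := RdqSource.assignProtected he hyr 0
  have hF₁ : C₁.Fair := hF.substConst y _
  have hC₁ : C₁.ComputesRestr f R₁ := hC.substConst_assignProtected he hyr 0
  let P₁ := C.substConstPacking y (finTwoEquiv 0) ∅
  have hP₁ : C₁.IsPacking P₁ := C.isPacking_empty.substConst
  have hyinf : y ∈ C.influential R := mem_filter.mpr ⟨mem_univ _, Or.inr hyp⟩
  have hinf₁ : ((C₁.influential R₁).card : ℝ) + 1 ≤ (C.influential R).card := by
    have h1 := C.influential_substConst_assignProtected_subset he hyr 0 (finTwoEquiv 0)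
    have h2 : C₁.influential R₁ ⊆ (C.influential R).erase y := fun i hi => (mem_filter.mp (h1 hi)).1
    have h3 := card_le_card h2
    have h4 := card_erase_add_one hyinf
    have : (C₁.influential R₁).card + 1 ≤ (C.influential R).card := by omega
    exact_mod_cast this
  have hq₁ : R₁.quadCount + 1 = R.quadCount := RdqSource.quadCount_assignProtected he hyr 0
  have hdim₁ : R₁.dim + 1 = R.dim := RdqSource.dim_assignProtected he hyr 0
  have hμ₁ : C₁.measure αφ αI αQ P₁ R₁ ≤ C.measure αφ αI αQ ∅ R - αI - αQ := by
    have h := C.measure_substConst_le hφ αI αQ C.isPacking_empty R R₁ y (finTwoEquiv 0)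
    have hq' : ((R.quadCount : ℕ) : ℝ) = R₁.quadCount + 1 := by exact_mod_cast hq₁.symm
    rw [hq'] at h
    nlinarith
  -- step 2: `v := 0`
  have he'₁ : R₁.quad l' = some e' := by
    rw [RdqSource.assignProtected_quad_of_ne he hyr 0 (Ne.symm hll)]; exact he'
  let C₂ := C₁.substConst v (finTwoEquiv 0)
  let R₂ := RdqSource.assignProtected (R := R₁) he'₁ hvr 0
  have hF₂ : C₂.Fair := hF₁.substConst v _
  have hC₂ : C₂.ComputesRestr f R₂ := hC₁.substConst_assignProtected he'₁ hvr 0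
  let P₂ := C₁.substConstPacking v (finTwoEquiv 0) P₁
  have hP₂ : C₂.IsPacking P₂ := hP₁.substConst
  have hvp₁ : R₁.Protected v :=
    (RdqSource.protected_assignProtected_iff he hyr 0 v).mpr ⟨RdqSource.free_of_reads he' hvr, l', e', Ne.symm hll, he', hvr⟩
  have hvinf : v ∈ C₁.influential R₁ := mem_filter.mpr ⟨mem_univ _, Or.inr hvp₁⟩
  have hinf₂ : ((C₂.influential R₂).card : ℝ) + 1 ≤ (C₁.influential R₁).card := by
    have h1 := C₁.influential_substConst_assignProtected_subset he'₁ hvr 0 (finTwoEquiv 0)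
    have h2 : C₂.influential R₂ ⊆ (C₁.influential R₁).erase v := fun i hi => (mem_filter.mp (h1 hi)).1
    have h3 := card_le_card h2
    have h4 := card_erase_add_one hvinf
    have : (C₂.influential R₂).card + 1 ≤ (C₁.influential R₁).card := by omega
    exact_mod_cast this
  have hq₂ : R₂.quadCount + 1 = R₁.quadCount := RdqSource.quadCount_assignProtected he'₁ hvr 0
  have hdim₂ : R₂.dim + 1 = R₁.dim := RdqSource.dim_assignProtected he'₁ hvr 0
  have hμ₂ : C₂.measure αφ αI αQ P₂ R₂ ≤ C₁.measure αφ αI αQ P₁ R₁ - αI - αQ := by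
    have h := C₁.measure_substConst_le hφ αI αQ hP₁ R₁ R₂ v (finTwoEquiv 0)
    have hq' : ((R₁.quadCount : ℕ) : ℝ) = R₂.quadCount + 1 := by exact_mod_cast hq₂.symm
    rw [hq'] at h
    nlinarith
  -- wires and out-degrees at `P` are unchanged
  have hPx₂ : C₂.arg P a = .var x := by
    show ((C.arg P a).substConst y _).substConst v _ = _
    rw [hPx, Node.substConst_var_of_ne hyx.symm, Node.substConst_var_of_ne hxv]
  have hPu₂ : C₂.arg P a.rev = .var u := by
    show ((C.arg P a.rev).substConst y _).substConst v _ = _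
    rw [hPu, Node.substConst_var_of_ne hyu.symm, Node.substConst_var_of_ne hvu.symm]
  have hx1₂ : C₂.fanout (.var x) = 1 := by
    show ((C.substConst y (finTwoEquiv 0)).substConst v (finTwoEquiv 0)).fanout (.var x) = 1
    rw [(C.substConst y (finTwoEquiv 0)).fanout_substConst_var_of_ne _ _ hxv, C.fanout_substConst_var_of_ne _ _ hyx.symm]
    exact hx1
  have hu1₂ : C₂.fanout (.var u) = 1 := by
    show ((C.substConst y (finTwoEquiv 0)).substConst v (finTwoEquiv 0)).fanout (.var u) = 1
    rw [(C.substConst y (finTwoEquiv 0)).fanout_substConst_var_of_ne _ _ hvu.symm, C.fanout_substConst_var_of_ne _ _ hyu.symm]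
    exact hu1
  have hxor₂ : IsXorOp (C₂.op P) := hxor
  -- step 3: the source after `x := u + 0`
  have hxfree₂ : R₂.Free x := (RdqSource.free_assignProtected_iff he'₁ hvr 0 x).mpr
    ⟨(RdqSource.free_assignProtected_iff he hyr 0 x).mpr ⟨hxp.1, hyx.symm⟩, hxv⟩
  have hxp₂ : ¬ R₂.Protected x := fun h =>
    RdqSource.not_protected_assignProtected_of_reads he hyr 0 hex (RdqSource.protected_of_protected_assignProtected he'₁ hvr 0 h)
  have hufree₂ : R₂.Free u := (RdqSource.free_assignProtected_iff he'₁ hvr 0 u).mpr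
    ⟨(RdqSource.free_assignProtected_iff he hyr 0 u).mpr ⟨hup.1, hyu.symm⟩, hvu.symm⟩
  let Eq : LinEq n := ⟨{u}, 0⟩
  have hEq : ∀ i ∈ Eq.support, R₂.lin i = none ∧ i ≠ x := by
    intro i hi
    have : i = u := by simpa [Eq] using hi
    subst this
    exact ⟨hufree₂.1, hxu.symm⟩
  let R₃ := R₂.assignLin x Eq hxfree₂ hxp₂ hEq
  have hsol : ∀ w, w ∈ R₃.Sol ↔ w ∈ R₂.Sol ∧ w x = w u + 0 := by
    intro w
    rw [RdqSource.mem_sol_assignLin_iff]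
    have : Eq.eval w = w u + 0 := by
      show (0 : ZMod 2) + ∑ i ∈ ({u} : Finset (Fin n)), w i = _
      rw [sum_singleton, add_comm]
    rw [this]
  have hfree : ∀ i, R₃.Free i ↔ R₂.Free i ∧ i ≠ x := RdqSource.free_assignLin_iff hxfree₂ hxp₂ hEq
  have hprot : ∀ i, R₃.Protected i → R₂.Protected i := fun i h =>
    (RdqSource.protected_assignLin_iff hxfree₂ hxp₂ hEq i).mp h
  have hup₂ : ¬ R₂.Protected u := RdqSource.not_protected_assignProtected_of_reads he'₁ hvr 0 heu
  have hup₃ : ¬ R₃.Protected u := fun h => hup₂ (hprot u h)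
  have hdim₃ : R₃.dim + 1 = R₂.dim := RdqSource.dim_assignLin hxfree₂ hxp₂ hEq
  have hq₃ : R₃.quadCount = R₂.quadCount := RdqSource.quadCount_assignLin hxfree₂ hxp₂ hEq
  have hd₃ : 2 * d ≤ R₃.dim := by
    have h1 : R₃.dim + 1 = R₂.dim := hdim₃
    have h2 : R₂.dim + 1 = R₁.dim := hdim₂
    have h3 : R₁.dim + 1 = R.dim := hdim₁
    omega
  obtain ⟨D', P', hF', hC', hP', -, hμ'⟩ := case6_2_2_core (C := C₂) (αQ := αQ) hf hd₃ hF₂ hC₂ hP₂ hPx₂ hPu₂ hxu hxor₂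
    hx1₂ hu1₂ hsol hfree hufree₂ hprot hup₃ hdim₃ hφ hI hq₃.le
  have hdimt : R₃.dim + 3 = R.dim := by
    have h1 : R₃.dim + 1 = R₂.dim := hdim₃
    have h2 : R₂.dim + 1 = R₁.dim := hdim₂
    have h3 : R₁.dim + 1 = R.dim := hdim₁
    omega
  refine Or.inr ⟨3, by norm_num, le_rfl, D', R₃, P', hF', hC', hP', hdimt, ?_⟩
  have hδ := liYangDelta_le_four_thirds αφ αI αQ
  have hq' : ((R₂.quadCount : ℕ) : ℝ) - R₃.quadCount = 0 := by rw [hq₃]; ring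
  rw [hq', mul_zero, sub_zero] at hμ'
  push_cast
  nlinarith

/-- **Cases 6.2.2.1–6.2.2.3 of the proof of Thm. 4.1, dispatched**: under the standing
assumptions, a gate `P` reading a protected variable `x` and, at its other position, a
`1`-variable `u` yields the one-step conclusion — `u` unprotected (6.2.2.1), the couple of `x`
(6.2.2.2), or protected in another couple (6.2.2.3). Invoked again by Cases 8.2.5.1.2 and
8.2.5.2.1.4 ("`1`-variables `x_m` and `x_k` feed a common ⊕-type gate `P′`. Similar to
Case 6.2.2.1 ∼ Case 6.2.2.3, we can perform affine substitutions").
[cite: LiYang2022, §4.1 (Cases 6.2.2.1–6.2.2.3, 8.2.5.1.2, 8.2.5.2.1.4)] -/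
theorem case6_2_2_oneVar (hf : IsAffineDisperser f d) (hd : 2 * d + 2 < R.dim) (hF : C.Fair)
    (hC : C.ComputesRestr f R) (hS : C.Standing R) (hφ : 0 ≤ αφ) (hφ2 : αφ ≤ 1 / 2) (hI : 0 ≤ αI) (hQ : 0 ≤ αQ)
    {P : Fin C.m} {a : Fin 2} {x u : Fin n}
    (hPx : C.arg P a = .var x) (hPu : C.arg P a.rev = .var u) (hxp : R.Protected x)
    (hu1 : C.fanout (.var u) = 1) : C.StepGoal f R αφ αI αQ := by
  by_cases hup : R.Protected u
  · obtain ⟨-, l, e, he, hex⟩ := hxp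
    obtain ⟨-, l', e', he', heu⟩ := hup
    have hex : e.Reads x := hex
    have heu : e'.Reads u := heu
    by_cases hll : l = l'
    · subst hll
      rw [he] at he'
      obtain rfl := Option.some.inj he'
      exact case6_2_2_2 hf hd hF hC hS hφ hφ2 hI hQ hPx hPu he hex
        (e.other_eq_of_reads hex heu (ne_of_arg_var hS.normalized.1 hPx hPu))
    · exact case6_2_2_3 hf hd hF hC hS hφ hφ2 hI hQ hPx hPu he hex he' heu hll
  · exact case6_2_2_1 hf hd hF hC hS hφ hφ2 hI hQ hPx hPu hxp hup hu1

/-- **Case 6.2.2.4 of the proof of Thm. 4.1**: the gate `P` reading the protected variable `x`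
is a `1`-gate whose reader `B` is ∧-type and reads, at its other position, a variable `t`
("`u` is a `2`-variable, which means that `P` must be a `1`-gate … `B` is an ∧-type gate fed by
`P` and a variable `t`. We substitute appropriate constant value to `t` to trivialize `B`, which
allows us to further remove `P` by Rule 1. We then substitute constant value to the couple of `x`
to make it unprotected. These two substitutions make three variables (`x`, `t` and the couple of
`x`) non-influential, resulting in `Δμ ≥ 3α_I/2`"): here with the eliminations of `B`
(trivialized, `ΔΦ ≤ 1`) and `P` (Rule 1, `ΔΦ ≤ 2`) counted, `Δμ ≥ 3α_I + α_Q + 2 - 3α_φ ≥ 2δ`.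
[cite: LiYang2022, §4.1 (Case 6.2.2.4), Lemma 3.11] -/
theorem case6_2_2_4 (hf : IsAffineDisperser f d) (hd : 2 * d + 2 < R.dim) (hF : C.Fair)
    (hC : C.ComputesRestr f R) (hS : C.Standing R) (hφ : 0 ≤ αφ) (hφ2 : αφ ≤ 1 / 2) (hI : 0 ≤ αI) (hQ : 0 ≤ αQ)
    {P B : Fin C.m} {a aB : Fin 2} {x t : Fin n}
    (hPx : C.arg P a = .var x) (hxp : R.Protected x) (hP1 : C.fanout (.gate P) = 1)
    (hBand : IsAndOp (C.op B)) (hBP : C.arg B aB = .gate P) (hBt : C.arg B aB.rev = .var t) :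
    C.StepGoal f R αφ αI αQ := by
  classical
  have hN := hS.normalized.1
  have hx1 := hS.fanout_eq_one_of_protected hxp hPx
  have hPand : ¬ IsAndOp (C.op P) := hS.protected_not_and x hxp P a hPx
  obtain ⟨hxfree, l, e, he, hex⟩ := hxp
  have hex : e.Reads x := hex
  set y := e.other x with hy
  have hyr : e.Reads y := e.reads_other x
  have hyp : R.Protected y := RdqSource.protected_of_reads he hyr
  have hyx : y ≠ x := e.other_ne hex (R.quad_wf l e he).2.2
  -- `t` feeds the ∧-type gate `B`: unprotected (Case 1), free, distinct from `x`, `y`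
  have htp : ¬ R.Protected t := fun h => hS.protected_not_and t h B aB.rev hBt hBand
  have ht : R.Free t := free_of_reads hC hBt
  have htx : t ≠ x := fun h => htp (h ▸ ⟨hxfree, l, e, he, hex⟩)
  have hPB : P ≠ B := fun h => hPand (h ▸ hBand)
  -- the other wire of `P` is not `x` (no coinciding wires), so `P` reads `x` exactly once
  have hPr : C.arg P a.rev ≠ .var x := by
    intro h
    apply hN.arg_zero_ne_arg_one P
    rcases fin2_eq_or_eq_rev 0 a with rfl | h'
    · have h1 : C.arg P 1 = .var x := h
      rw [hPx, h1]
    · have ha : a = 1 := h'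
      subst ha
      have h0 : C.arg P 0 = .var x := h
      rw [h0, hPx]
  -- step 1: `t := c` trivializing `B`
  obtain ⟨b, hb⟩ := exists_trivializing hBand aB.rev
  let c : ZMod 2 := finTwoEquiv.symm b
  have hbc : finTwoEquiv c = b := finTwoEquiv.apply_symm_apply b
  let C₁ := C.substConst t (finTwoEquiv c)
  let R₁ := R.assignFree t c ht htp
  have hF₁ : C₁.Fair := hF.substConst t _
  have hC₁ : C₁.ComputesRestr f R₁ := hC.substConst_assignFree ht htp c
  let P₁ := C.substConstPacking t (finTwoEquiv c) ∅
  have hP₁ : C₁.IsPacking P₁ := C.isPacking_empty.substConst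
  have hdim₁ : R₁.dim + 1 = R.dim := RdqSource.dim_assignFree ht htp
  have htinf : t ∈ C.influential R := C.mem_influential_of_reads R hBt
  have hμ₁ : C₁.measure αφ αI αQ P₁ R₁ ≤ C.measure αφ αI αQ ∅ R - αI := by
    have h := C.measure_substConst_le hφ αI αQ C.isPacking_empty R R₁ t (finTwoEquiv c)
    have hsub := C.influential_substConst_assignFree_subset ht htp c (finTwoEquiv c)
    have h3 := card_le_card hsub
    have h4 := card_erase_add_one htinf
    have hinf : ((C₁.influential R₁).card : ℝ) + 1 ≤ (C.influential R).card := by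
      have : (C₁.influential R₁).card + 1 ≤ (C.influential R).card := by
        change ((C.substConst t (finTwoEquiv c)).influential (R.assignFree t c ht htp)).card + 1 ≤ _
        omega
      exact_mod_cast this
    have hq : ((R₁.quadCount : ℕ) : ℝ) = R.quadCount := rfl
    rw [hq] at h
    nlinarith
  -- wires of `C₁` at `B` and `P`
  have h₀ : C₁.arg B aB.rev = .const b := by
    show (C.arg B aB.rev).substConst t (finTwoEquiv c) = _; rw [hBt, Node.substConst_var_self, hbc]
  have hBP₁ : C₁.arg B aB = .gate P := by
    show (C.arg B aB).substConst t (finTwoEquiv c) = _; rw [hBP]; rfl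
  have hPx₁ : C₁.arg P a = .var x := by
    show (C.arg P a).substConst t _ = _; rw [hPx, Node.substConst_var_of_ne htx.symm]
  have hPr₁ : C₁.arg P a.rev ≠ .var x := by
    show (C.arg P a.rev).substConst t _ ≠ _
    intro h
    exact hPr (Node.substConst_eq_var_iff.mp h).1
  have hx1₁ : C₁.fanout (.var x) = 1 := by
    show (C.substConst t (finTwoEquiv c)).fanout (.var x) = 1
    rw [C.fanout_substConst_var_of_ne _ _ htx.symm]; exact hx1
  have htriv : C₁.liveFn B aB.rev b false = C₁.liveFn B aB.rev b true := hb
  have houtB : C₁.out ≠ .gate B := out_ne_of_trivialized hf (by omega) hF₁ hC₁ h₀ htriv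
  -- step 2: eliminate the trivialized `B`
  let E₁ := elimDataWTriv hF₁ hC₁ hP₁ h₀ htriv houtB hφ hI αQ
  have hrepl : E₁.repl = .const (C₁.liveFn B aB.rev b false) := rfl
  have hμE := E₁.measure_le
  obtain ⟨kP, hkP⟩ := E₁.ι_surj P hPB
  have hP0 : E₁.C'.fanout (.gate kP) = 0 := by
    have h1 := E₁.fanout_gate_add (k' := kP) (by rw [hrepl]; exact fun h => by cases h)
    rw [hkP] at h1
    have h2 : C₁.fanout (.gate P) = 1 := by rw [C.fanout_substConst_gate]; exact hP1
    have h3 : 1 ≤ (univ.filter fun a' : Fin 2 => C₁.arg B a' = .gate P).card :=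
      card_pos.mpr ⟨aB, mem_filter.mpr ⟨mem_univ _, hBP₁⟩⟩
    omega
  -- `P` is not the output: otherwise the output `P` would be read by the ∧-type gate `B`, from
  -- which the output is reachable (Case 0.2) only through acyclic gates of rank above `B > P`
  by_cases hout₂ : E₁.C'.out = .gate kP
  · exfalso
    have hCout : C.out = .gate P := by
      have := E₁.out_eq
      rw [hout₂, if_neg houtB] at this
      change Node.gate (E₁.ι kP) = C₁.out at this
      rw [hkP] at this
      obtain ⟨ko, hko⟩ := exists_out_eq_gate' hf hF hC (by omega)
      have hCo : C₁.out = C.out.substConst t (finTwoEquiv c) := rfl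
      rw [hCo, hko] at this
      have e1 : (Node.gate ko : Node n C.m).substConst t (finTwoEquiv c) = .gate ko := rfl
      rw [e1] at this
      rw [hko, ← this]
    have hBK : B ∉ C.xorPart := C.not_mem_xorPart_of_isAndOp hBand
    have hPK : P ∉ C.xorPart := fun hPK => out_ne_gate_of_mem_xorPart hf (by omega) hF hC hPK hCout
    obtain ⟨ρ, hρ⟩ := C.acyclic
    obtain ⟨k, hk, hpath⟩ := hS.reachesOut B hBK
    rw [hCout] at hk
    cases hk
    have key : ∀ k', Relation.ReflTransGen C.Reads B k' → k' ∉ C.xorPart ∧ ρ B ≤ ρ k' := by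
      intro k' hp
      induction hp with
      | refl => exact ⟨hBK, le_rfl⟩
      | tail _ hread ih =>
        obtain ⟨a', ha'⟩ := hread
        rename_i b' c' _
        have hcK : c' ∉ C.xorPart := fun hcK => ih.1 (C.mem_of_arg_eq c' hcK a' b' ha')
        exact ⟨hcK, ih.2.trans (hρ c' hcK a' b' ha' ih.1).le⟩
    have h1 := (key P hpath).2
    have h2 : ρ P < ρ B := hρ B hBK aB P hBP hPK
    omega
  -- step 3: delete the `0`-gate `P` (Rule 1, `ΔΦ ≤ 2`)
  have hno : ∀ k a', E₁.C'.arg k a' ≠ .gate kP := (fanout_eq_zero_iff _ _).mp hP0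
  let ε₂ := E₁.C'.skipEquiv kP
  obtain ⟨P₂, hF₂, hC₂, hP₂, hm₂, hμ₂⟩ :=
    E₁.C'.measure_removeGate_le kP ε₂ E₁.fair E₁.computes E₁.packing hno hout₂ hφ hI αQ
  set C₂ := E₁.C'.removeGate kP ε₂ with hC₂def
  have hcard : ((((univ : Finset (Fin 2)).filter fun a' => ∀ b', E₁.C'.arg kP a' ≠ .const b').card : ℕ) : ℝ) ≤ 2 := by
    have := card_filter_le (univ : Finset (Fin 2)) (fun a' => ∀ b', E₁.C'.arg kP a' ≠ .const b')
    rw [card_univ, Fintype.card_fin] at this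
    exact_mod_cast this
  -- `x` is a `0`-variable of `C₂`
  have hkPx : E₁.C'.arg kP a = .var x := (E₁.arg_eq_var_iff kP a x).mpr (Or.inl (by rw [hkP]; exact hPx₁))
  have hkPr : E₁.C'.arg kP a.rev ≠ .var x := by
    intro h
    rw [E₁.arg_eq_var_iff, hkP] at h
    rcases h with h | ⟨-, h⟩
    · exact hPr₁ h
    · rw [hrepl] at h; cases h
  have hx1' : E₁.C'.fanout (.var x) = 1 := by
    have h := E₁.fanout_var_add (i := x) (by rw [hrepl]; exact fun h => by cases h)
    have h0' : (univ.filter fun a' : Fin 2 => C₁.arg B a' = .var x).card = 0 := by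
      rw [card_eq_zero, filter_eq_empty_iff]
      intro a' _ h'
      rcases fin2_eq_or_eq_rev aB a' with rfl | rfl
      · rw [hBP₁] at h'; cases h'
      · rw [h₀] at h'; cases h'
    rw [h0', hx1₁] at h
    omega
  have hx0 : C₂.fanout (.var x) = 0 := by
    have h := E₁.C'.fanout_removeGate_var_add kP ε₂ hno x
    have h1 : (univ.filter fun a' : Fin 2 => E₁.C'.arg kP a' = .var x).card = 1 := by
      rw [card_eq_one]
      refine ⟨a, ?_⟩
      ext a'
      simp only [mem_filter, mem_univ, true_and, mem_singleton]
      constructor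
      · intro h'
        rcases fin2_eq_or_eq_rev a a' with rfl | rfl
        · rfl
        · exact absurd h' hkPr
      · rintro rfl; exact hkPx
    rw [h1, hx1'] at h
    change C₂.fanout (.var x) + 1 = 1 at h
    omega
  -- step 4: `y := 0` (the couple of `x`); `x` and `y` are no longer influential
  have he₁ : R₁.quad l = some e := he
  let C₃ := C₂.substConst y (finTwoEquiv 0)
  let R₂ := RdqSource.assignProtected (R := R₁) he₁ hyr 0
  have hF₃ : C₃.Fair := hF₂.substConst y _
  have hC₃ : C₃.ComputesRestr f R₂ := hC₂.substConst_assignProtected he₁ hyr 0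
  have hP₃ : C₃.IsPacking (C₂.substConstPacking y (finTwoEquiv 0) P₂) := hP₂.substConst
  have hyp₁ : R₁.Protected y := (RdqSource.protected_assignFree_iff ht htp y).mpr hyp
  have hxp₁ : R₁.Protected x := (RdqSource.protected_assignFree_iff ht htp x).mpr ⟨hxfree, l, e, he, hex⟩
  have hyinf : y ∈ C₂.influential R₁ := mem_filter.mpr ⟨mem_univ _, Or.inr hyp₁⟩
  have hxinf : x ∈ C₂.influential R₁ := mem_filter.mpr ⟨mem_univ _, Or.inr hxp₁⟩
  have hinf₃ : ((C₃.influential R₂).card : ℝ) + 2 ≤ (C₂.influential R₁).card := by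
    have h1 := C₂.influential_substConst_assignProtected_subset he₁ hyr 0 (finTwoEquiv 0)
    have h2 : C₃.influential R₂ ⊆ ((C₂.influential R₁).erase y).erase x := by
      intro i hi
      have hi' := h1 hi
      rw [mem_filter] at hi'
      refine mem_erase.mpr ⟨?_, hi'.1⟩
      rintro rfl
      have := hi'.2 hex
      rw [hx0] at this
      exact absurd this (by norm_num)
    have h3 := card_le_card h2
    have h4 := card_erase_add_one hyinf
    have h5 := card_erase_add_one (mem_erase.mpr ⟨hyx.symm, hxinf⟩)
    have : (C₃.influential R₂).card + 2 ≤ (C₂.influential R₁).card := by omega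
    exact_mod_cast this
  have hq₂ : R₂.quadCount + 1 = R₁.quadCount := RdqSource.quadCount_assignProtected he₁ hyr 0
  have hdim₂ : R₂.dim + 1 = R₁.dim := RdqSource.dim_assignProtected he₁ hyr 0
  have hμ₃ : C₃.measure αφ αI αQ (C₂.substConstPacking y (finTwoEquiv 0) P₂) R₂ ≤
      C₂.measure αφ αI αQ P₂ R₁ - 2 * αI - αQ := by
    have h := C₂.measure_substConst_le hφ αI αQ hP₂ R₁ R₂ y (finTwoEquiv 0)
    have hq' : ((R₁.quadCount : ℕ) : ℝ) = R₂.quadCount + 1 := by exact_mod_cast hq₂.symm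
    rw [hq'] at h
    nlinarith
  -- conclusion: `t = 2`, `Δμ ≥ 3α_I + α_Q + 2 - 3α_φ ≥ 2δ`
  refine Or.inr ⟨2, by norm_num, by norm_num, C₃, R₂, _, hF₃, hC₃, hP₃, by omega, ?_⟩
  have hδ := liYangDelta_le_four_thirds αφ αI αQ
  push_cast
  nlinarith [mul_le_mul_of_nonneg_left hcard hφ]

end Standing

end Semicircuit

end Literature.Computability.Complexity
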